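import Summits.BirchSwinnertonDyer.BirchSwinnertonDyer.Theorems.ErratumRoadFiveNonSurjCornerHybridMaxSupplyCore
import Summits.BirchSwinnertonDyer.BirchSwinnertonDyer.Theorems.ErratumRoadFiveEulerHalfNotRamLABIndexGuard
import HarnessLib

/-!
# Route `ErratumRoadFive` (rung K2), crux `NonSurjCorner` (item stmt-BirchSwinnertonDyer-19065), line `Lines/hybrid.lean`:
# GLUE #22 — the composition of the r20 skeleton candidate: FIVE stubs {deep witness, twin-lower SUPPLIES (∃), fifteen facts, 2 + 4 Shimura ∕ MAX names,
# (B6)@carriers}; NO Hida facts, NO μ-slot on the Euler side, NO crux 19064 — and the projections showing r19's slots (or 19064) imply slot 2″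
# (cell `bsd-stepL`, seat `bsd-stepL-corner-p1` g18; `--supports stmt-BirchSwinnertonDyer-19065 --as helper`)

WHY THIS FILE. `…HybridMaxSupplyCore` (this seat g18) re-keys the MAX road on an ∃-shaped twin-lower supply; the multi-carrier inert road was already
keyed on the ∃-supply `FHTwinLowerSupplyAt W p` (lane A g13 ∕ lane B at 3). So the twin's LOWER half — the last ∀-shaped twin input of the hybrid line,
produced on the line of record from μ = 0 (slot 2′) through the six Hida facts (slot 4), or from crux 19064 — can be asked AS THE SUPPLIES THEMSELVES:
per corner pair, for every even set `T` of multiplicative primes SOME Friedberg–Hoffstein field (`T` inert) with the twist's `≥`-display, and SOME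
Heegner field with `2` split with the twist's `≥`-half. Per pair each supply is ONE computation (a field whose twist has `p ∤ #Ш_an` makes the half
trivial; lane B's height census certified such data on `N ≤ 10¹⁰`); class-wide it is «Friedberg–Hoffstein ∧ the X11a lower half», asked existentially —
the EXACT analogue of lane B's `CornerAtThreeFHTwinLowerSupply` ∕ `CornerTwinLowerModEight` at 3. After r20 the line reads: converse half = ONE deep
witness per DEEP pair (1 ∕ 2 430 at 5, 0 ∕ 57 at 7); Euler half = Kolyvagin ∕ Shimura roads + two ∃-supplies per pair + (B6)@carriers + print.
* §1 GLUE #22 `nonSurjCorner_of_deepWitness_of_twinLowerSupply_of_fifteenFacts_of_twoPlusFourNamedInputs_of_carrierLabelsB6_pAnchor`;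
* §2 `twinLowerSupply_of_lowerLeafTwinDeep` (leaf-twin lower half + FH ×2 ⟹ supplies), `twinLowerSupply_of_twinLowerMuAn_of_hidaFacts` (r19's slots
  2′ + 4 + facts ⟹ slot 2″), `twinLowerSupply_of_x11aLowerHalf` (19064 ⟹ slot 2″);
* §3 (appended) `nonSurjCornerOfItemsSupply_holds` — the by-items glue in SHAPE D (children {DeepWitness, TwinLowerSupply, Kato child}; six top-level
  items; crux 19064 NOT in the cone).

HONEST FRAMING: FIVE THEOREMS (no definition, no named fact, no `sorry`); CONDITIONAL on every displayed binder; no stub is proved — an open input is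
asked existentially instead of universally; 19065 NOT closed by this file; nothing about any curve's BSD; BSD is not advanced; T7.
References (locators only): [cite: Cha2005, Thm. 21 and Rmk. 25] [cite: McCallumLMS1991, §5 Cor. 5.6] [cite: Kato2004Asterisque, Thm. 12.4, §17.13]
[cite: HoffsteinLuo1997, Theorem (§1)] [cite: FriedbergHoffstein1995, Thm. B] [cite: EmertonPollackWeston2006, Thm. 5.1.3] [cite: Wan2015, Thm. 4]
[cite: Mazur1978, Cor. 4.1] [cite: PastenShimura2024, Prop. 6.13, Lemma 6.18] [cite: Miller2011LMS, Def. 1.1].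
-/

set_option autoImplicit false
set_option linter.dupNamespace false -- `Summit.BirchSwinnertonDyer.BirchSwinnertonDyer` (summit = problem), tree-wide

noncomputable section

open scoped Classical NumberField MatrixGroups ModularForm

/-! ### §1 Glue #22: the composition with both twin inputs ∃-shaped -/

namespace Summit.BirchSwinnertonDyer.BirchSwinnertonDyer.Theorems

open CongruenceSubgroup WeierstrassCurve NumberField IsDedekindDomain Field Rat.HeightOneSpectrum
  Literature.NumberTheory.EllipticCurves
  Literature.NumberTheory.EllipticCurves.ModularForms
  Literature.NumberTheory.Automorphic
  Literature.NumberTheory.EllipticCurves.Rank1Residual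
  Literature.NumberTheory.EllipticCurves.Rank1Residual.Typed
  Literature.NumberTheory.EllipticCurves.Wuthrich2014
  Literature.NumberTheory.EllipticCurves.SteinWuthrich2013
  Literature.NumberTheory.EllipticCurves.Greenberg1999
  Literature.NumberTheory.EllipticCurves.Kato2004
  Literature.NumberTheory.EllipticCurves.BarriosEtAl2025
  Literature.NumberTheory.EllipticCurves.EmertonPollackWeston2006
  Literature.NumberTheory.EllipticCurves.ShimuraCMFamily
  Literature.NumberTheory.GaloisRepresentations Literature.NumberTheory.GaloisCohomology
  Summit.BirchSwinnertonDyer.Rank1Residual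
  Summit.BirchSwinnertonDyer.Rank1Residual.X11b
  Summit.BirchSwinnertonDyer.Rank1Residual.X11b.Three.Koly
  Summit.BirchSwinnertonDyer.BirchSwinnertonDyer.Theses.ErratumRoadFive

/-- **GLUE #22 — glue #21H with the Euler half's twin input ∃-RECUT and slot 4 GONE.** Binders: `hWit` (slot 1′: one deep witness per deep pair) →
`hSup2` (slot 2″: at every corner pair, the inert-frame twin-lower supply `FHTwinLowerSupplyAt W p` ∧ the MAX-frame supply — SOME Heegner field with
`2` split, `|d_K| > 4`, `L(E^{(d_K)},1) ≠ 0`, with the twist's `≥`-half) → `hF3` (fifteen facts; conjunct 6, the one-prime Friedberg–Hoffstein fact, is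
now idle in the composition) → hMax2 → hShim4 (conjunct 1, Friedberg–Hoffstein inert, idle) → `hLabB6T` → `NonSurjCorner`. NO Hida facts, NO μ-slot on
the Euler side. Proof = glue #21H over `…HybridMaxSupplyCore` §2. CONDITIONAL on every binder; 19065 NOT closed; nothing booked; T7.
[cite: Kato2004Asterisque, Thm. 12.4, §17.13 (pp. 279–280)] [cite: Mazur1978, Cor. 4.1] [cite: Cha2005, Thm. 21 and Rmk. 25] [cite: McCallumLMS1991, §5 Cor. 5.6]
[cite: HoffsteinLuo1997, Theorem (§1)] [cite: PastenShimura2024, Lemma 6.18] [cite: Miller2011LMS, Def. 1.1] -/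
theorem nonSurjCorner_of_deepWitness_of_twinLowerSupply_of_fifteenFacts_of_twoPlusFourNamedInputs_of_carrierLabelsB6_pAnchor
    -- slot 1′ (r19): ONE DEEP WITNESS per deep corner pair (slots 1 + 2b of r18 merged, ∃-recut)
    (hWit : ∀ (W : WeierstrassCurve ℚ) [W.IsElliptic] [W.IsGloballyMinimal] (p : ℕ) [Fact p.Prime],
        ClassX11b W p → ¬ Surj W p → (p = 5 ∨ p = 7) → p ∣ padicValInt p W.minimalDiscriminantInt →
        ¬ Ram W p → (∃ s : ℚ, shaAn W = (s : ℂ) ∧ 0 < padicValRat p s) →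
        ∃ (N : ℕ) (_ : NeZero N) (K : Type) (_ : Field K) (_ : NumberField K)
          (Dt : ModularParametrizationData W N) (H : HeegnerDatum N (NumberField.discr K)) (ι : K →+* ℂ)
          (P : (W.baseChange K).toAffine.Point),
          W.conductorNorm ℤ = N ∧ IsImaginaryQuadratic K ∧ 4 < (NumberField.discr K).natAbs ∧
          SatisfiesHeegnerHypothesis N K ∧ (W.quadraticTwist (NumberField.discr K : ℚ)).entireLFunction 1 ≠ 0 ∧
          WeierstrassCurve.Affine.Point.map ι.toRatAlgHom P = heegnerPointComplex Dt H ∧ ¬ (p : ℤ) ∣ Dt.c ∧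
          ((∃ (d₁ : KolyvaginHeegnerData Dt H.β ι 1) (y : (W.baseChange K).toAffine.Point),
              WeierstrassCurve.Affine.Point.map (W' := W) (algebraMap K (ringClassField K ι 1)).toRatAlgHom y =
                d₁.derivedPoint ∧
              ∃ Q : (W.baseChange K).toAffine.Point, ((p ^ (padicValNat p W.tamagawaProduct + 1) : ℕ) : ℤ) • Q = y) →
            ∃ M : ℕ, M ≤ padicValNat p W.tamagawaProduct ∧ CertificateAt Dt H.β ι p M) ∧
          (∀ (Wd : WeierstrassCurve ℚ) [Wd.IsElliptic] [Wd.IsGloballyMinimal] (Cd : VariableChange ℚ),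
            Cd • W.quadraticTwist (NumberField.discr K : ℚ) = Wd →
            ClassX11a Wd p → ¬ Surj Wd p → p ∣ padicValInt p Wd.minimalDiscriminantInt →
            ∀ {N : ℕ} [NeZero N] (f : CuspForm (Gamma0 N) 2), IsNewformOf Wd f →
            ∀ (ϖ : ℚ), (ϖ : ℝ) * Wd.realPeriodRat = plusPeriod f →
            ∀ (a : ℚ_[p]) (L : PowerSeries ℚ_[p]),
              (Wd.HasSplitMultiplicativeReductionAtPrime p → a = 1) →
              (¬ Wd.HasSplitMultiplicativeReductionAtPrime p → a = -1) →
              IsMultPAdicLFunctionOf f p a L →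
              ∃ n : ℕ, ‖PowerSeries.coeff n (PowerSeries.C ((ϖ : ℚ) : ℚ_[p]) * L)‖ = 1))
    -- slot 2″ (r20): the twin-lower SUPPLIES of every corner pair (∃-shape): inert frames (`FHTwinLowerSupplyAt`) ∧ the MAX frame
    (hSup2 : ∀ (W : WeierstrassCurve ℚ) [W.IsElliptic] [W.IsGloballyMinimal] (p : ℕ) [Fact p.Prime],
        ClassX11b W p → ¬ Surj W p → (p = 5 ∨ p = 7) → p ∣ padicValInt p W.minimalDiscriminantInt → ¬ Ram W p →
        FHTwinLowerSupplyAt W p ∧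
        (∃ (K : Type) (_ : Field K) (_ : NumberField K), IsImaginaryQuadratic K ∧ 4 < (NumberField.discr K).natAbs ∧
          SatisfiesHeegnerHypothesis (W.conductorNorm ℤ) K ∧ SatisfiesHeegnerHypothesis 2 K ∧
          (W.quadraticTwist (NumberField.discr K : ℚ)).entireLFunction 1 ≠ 0 ∧
          ∀ (Wd : WeierstrassCurve ℚ) [Wd.IsElliptic] [Wd.IsGloballyMinimal] (Cd : VariableChange ℚ),
            Cd • W.quadraticTwist (NumberField.discr K : ℚ) = Wd → ¬ Surj Wd p → Typed.MissingLowerBoundAt Wd p))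
    -- slot 3 (r14): FIFTEEN named facts — r11–r13's sixteen minus conjunct 16 (Cha 2005 Rmk. 25 upper, discharged inside on the corner)
    (hF3 :
      (∀ (N : ℕ) [NeZero N] (W : WeierstrassCurve ℚ) (K : Type) [Field K] [NumberField K], Literature.NumberTheory.EllipticCurves.gross_zagier N W K) ∧
      (∀ (N : ℕ) [NeZero N] (W : WeierstrassCurve ℚ) (K : Type) [Field K] [NumberField K], Literature.NumberTheory.EllipticCurves.kolyvagin N W K) ∧
      Literature.NumberTheory.EllipticCurves.Wuthrich2014.sha_dvd_analyticSha ∧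
      Literature.NumberTheory.EllipticCurves.rank_eq_analyticRank_of_analyticRank_le_one ∧
      Literature.NumberTheory.EllipticCurves.ModularForms.exists_isNewformOf ∧
      Literature.NumberTheory.EllipticCurves.friedbergHoffstein_exists_heegnerField_split_twist_ne_zero ∧
      Literature.NumberTheory.EllipticCurves.ModularForms.mazur_not_dvd_maninConstant_of_odd ∧
      Literature.NumberTheory.EllipticCurves.SteinWuthrich2013.thm61_splitMultiplicative ∧
      Literature.NumberTheory.EllipticCurves.SteinWuthrich2013.thm61_nonsplitMultiplicative ∧
      (∀ (W : WeierstrassCurve ℚ) [W.IsElliptic] [W.IsGloballyMinimal] (p : ℕ) [Fact p.Prime], Literature.NumberTheory.EllipticCurves.greenberg_stevens (W := W) (p := p)) ∧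
      Literature.NumberTheory.EllipticCurves.Cha2005.rmk25_pow_dvd_card_sha_primary_of_certificate ∧
      Literature.NumberTheory.EllipticCurves.Kato2004.thm12_4 ∧
      Literature.NumberTheory.EllipticCurves.Kato2004.exists_multDivisibilityInputs_nonsplit_contra ∧
      Literature.NumberTheory.EllipticCurves.Kato2004.exists_multDivisibilityInputs_split_contra ∧
      Literature.NumberTheory.EllipticCurves.Kato2004.exists_multDivisibilityInputs_fine_contra)
    -- slot 4 (r7): the six Hida-side NAMED facts of x11a's non-surjective chain
    -- slot 5, conjunct 1 (r16): TWO names — Poitou–Tate for Selmer structures is a tree theorem (selmerComplement_canonical_holds)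
    (hMax2 : GrossLMS1991.prop37_2_frobeniusCongruence ∧ Gross1991_heegnerPoint_sub_ratTorsion_mem_E0_imageFree)
    -- slot 5, conjunct 2 (r17): FOUR Shimura names — the CM primitives come from slot 6's labelled family
    (hShim4 : friedbergHoffstein_exists_twist_ne_zero_inertAt ∧ nonempty_shimuraParametrizationData ∧
      PastenShimura2024_componentOrders ∧
      (∀ (K : Type) [Field K] [NumberField K], casselsTate_levelInputs K))
    -- slot 6 (r10): the labelled CM family at the corner's inert frames with `d_K < −4`, WITH (B6) ONLY AT THE CARRIER PRIMES outside `S`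
    (hLabB6T : ∀ (W : WeierstrassCurve ℚ) [W.IsElliptic] [W.IsGloballyMinimal] (p : ℕ) [Fact p.Prime],
      ClassX11b W p → ¬ Surj W p → (p = 5 ∨ p = 7) →
      ∀ (N : ℕ) [NeZero N] (K : Type) [Field K] [NumberField K] (S : Finset ℕ) (Dt : ModularParametrizationData W N)
        (X : ShimuraCurveData (∏ q ∈ S, q) (N / ∏ q ∈ S, q)) (W' : WeierstrassCurve ℚ) [W'.IsElliptic]
        (P₀ : ShimuraParametrizationData X W'),
        W.conductorNorm ℤ = N → IsImaginaryQuadratic K → NumberField.discr K < -4 → Even S.card →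
        (∀ ℓ ∈ S, ℓ.Prime ∧ ℓ ∣ N ∧ ¬ ℓ ^ 2 ∣ N ∧
          ((Ideal.span {(ℓ : ℤ)}).primesOver (𝓞 K)).ncard = 1 ∧ ¬ (ℓ : ℤ) ∣ NumberField.discr K) →
        (∀ ℓ : ℕ, ℓ.Prime → ℓ ∣ N → ℓ ∉ S → ((Ideal.span {(ℓ : ℤ)}).primesOver (𝓞 K)).ncard = 2) →
        p ∈ S → ¬ (p : ℤ) ∣ Dt.c → P₀.IsMinimalFor W →
        ∃ (ι : K →+* ℂ) (y : (W.baseChange K).toAffine.Point) (degy : ℕ)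
          (ys : (m : ℕ) → (W.baseChange (ringClassField K ι m)).toAffine.Point) (ε : ℤ), 0 < degy ∧
          padicValNat p degy = padicValNat p P₀.deg ∧
          LDerivEK W K = 8 * (Real.pi : ℂ) ^ 2 * peterssonProduct (CongruenceSubgroup.Gamma0 N) 2 Dt.f Dt.f /
              ((((Units.torsionOrder K : ℝ) / 2) ^ 2 * √|(NumberField.discr K : ℝ)| : ℝ) : ℂ) *
            ((y.canonicalHeight : ℂ) / (degy : ℂ)) ∧
          (¬ IsOfFinAddOrder y → 0 < (AddSubgroup.zmultiples y).index) ∧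
          ShimuraWalk.LabelsAt W N K ι y ys ε ∧
          ∀ (q : ℕ) [Fact q.Prime], q ∣ N → q ∉ S → p ∣ (W.baseChange ℚ_[q]).localTamagawaNumber ℤ_[q] → LabelB6 ι W N {q} ys) :
    Summit.BirchSwinnertonDyer.BirchSwinnertonDyer.Theses.ErratumRoadFive.NonSurjCorner := by
  obtain ⟨hGZ, hKo, -, hGZK, hnf, -, hMaz, hJs, hJn, hGS, hChaL, h12, hns', hsp', hfine'⟩ := hF3
  obtain ⟨h37, hF1⟩ := hMax2
  -- Poitou–Tate duality for the tree's Selmer structures: a THEOREM (Milne I 4.10(b) for the canonical maps, cell bsd-schneider p626891)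
  have hPTs : ∀ (K : Type) [Field K] [NumberField K], poitouTate_selmerStructure_duality_conj K :=
    poitouTate_conj_forall_of_selmerComplement_canonical
      (fun K _ _ n _ ↦ SchneiderFreeAdditiveX3.PoitouTateReduction.selmerComplement_canonical_holds K n)
  obtain ⟨-, hJL, hCO, hCT⟩ := hShim4
  -- the seven former slot-3 conjuncts that are THEOREMS of the tree
  have hmod : hasEntireLFunction_rat := hasEntireLFunction_rat_of_exists_isNewformOf hnf
  have hpar : nonempty_modularParametrizationData :=
    nonempty_modularParametrizationData_of_exists_isNewformOf hnf IsNewformOf.exists_maninConstant_ne_zero_holds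
  have hrec : ∀ (N : ℕ) [NeZero N] (W : WeierstrassCurve ℚ) (K : Type) [Field K] [NumberField K],
      heegnerPointOfConductor_one_galoisConj N W K :=
    fun N _ W K _ _ ↦ heegnerPointOfConductor_one_galoisConj_holds N W K
  have hD36 : ∀ (N : ℕ) [NeZero N] (W : WeierstrassCurve ℚ) (K : Type) [Field K] [NumberField K],
      phi_heegnerTau_mem_singularModuliField N W K :=
    fun N _ W K _ _ ↦ phi_heegnerTau_mem_singularModuliField_holds N W K
  have hPT : ∀ (K : Type) [Field K] [NumberField K],
      Literature.NumberTheory.GaloisCohomology.poitouTate_sum_localTatePairing_eq_zero K :=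
    poitouTate_sum_localTatePairing_eq_zero_holds
  have hBR : localTamagawaNumber_quadraticTwist_two_mem_of_goodReduction :=
    BarriosEtAl2025.localTamagawaNumber_quadraticTwist_two_mem_of_goodReduction_holds
  exact X11b.erratumRoadFive_nonSurjCorner_of_deepWitness_of_kolyJMax_of_multiUpper_of_maxTwinLowerSupply_of_twinUpper_of_casselsTate
    hGZ hKo hGZK hmod hnf hMaz hrec hD36 hChaL hCT h37
    (fun W _ _ p _ hX hns' h57 hv hnr ↦ (hSup2 W p hX hns' h57 hv hnr).2)
    (X11b.Three.Koly.nonSurjCornerKolyJ_max_of_threeNamedFacts h37 hPTs hF1)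
    (fun W _ _ p _ hX hns' h57 hv hnr htam hmulti ↦
      NonSurjCorner.missingUpperBoundAt_of_carrierLabelsB6_of_twinLower_pAnchor hGZK hmod hnf hMaz hBR hJL hCO hPT hPTs hCT hLabB6T W p hX
        hns' h57 htam hmulti (hSup2 W p hX hns' h57 hv hnr).1)
    (fun Wd _ _ p _ hXa hnsd hvd hμc ↦
      missingUpperBoundAt_of_classX11a_of_multDivisibilityAt hJs hJn hGZK hmod hpar Wd p (hGS Wd p) hXa
        (X11b.multDivisibilityAt_of_katoFacts_of_muAn_contra_of_mazur Kato2004.nonempty_iwasawaH1Data_holds h12 hnf hns' hsp' hfine'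
          hMaz Wd p hXa.2.1 hXa.2.2.1 hXa.2.2.2.1 hnsd hμc))
    hWit

/-! ### §2 The supplies from the leaf-twin lower half (so r19's slots 2′ + 4, or crux 19064, imply slot 2″) -/

/-- **Both twin-lower SUPPLIES of a corner pair from the leaf-twin lower half** (`h₄ℓ`: the `≥`-half of every non-surjective X11a leaf twin at `p` whose
`#Ш_an` is not a `p`-unit — on the line of record from μ = 0 + the six Hida facts through x11a's per-pair door, or from crux 19064 a fortiori), given
modularity, the inert-frame Friedberg–Hoffstein fact (for `FHTwinLowerSupplyAt`, this seat g13's `fhTwinLowerSupplyAt_of_lowerLeafTwinDeep`) and the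
one-prime Friedberg–Hoffstein fact (for the MAX frame: a Heegner field with `2` split). So the ∃-recut loses nothing: r19's slots imply r20's.
[cite: FriedbergHoffstein1995, Thm. B] [cite: HoffsteinLuo1997, Theorem (§1)] -/
theorem twinLowerSupply_of_lowerLeafTwinDeep
    (hGZK : rank_eq_analyticRank_of_analyticRank_le_one) (hmod : hasEntireLFunction_rat) (hnf : exists_isNewformOf)
    (hFHs : friedbergHoffstein_exists_heegnerField_split_twist_ne_zero) (hFH : friedbergHoffstein_exists_twist_ne_zero_inertAt)
    (h₄ℓ : ∀ (Wd : WeierstrassCurve ℚ) [Wd.IsElliptic] [Wd.IsGloballyMinimal] (p : ℕ) [Fact p.Prime],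
        ClassX11a Wd p → ¬ Surj Wd p → (p = 5 ∨ p = 7) → p ∣ padicValInt p Wd.minimalDiscriminantInt →
        ¬ X11a.ShaAnUnit Wd p → Typed.MissingLowerBoundAt Wd p) :
    ∀ (W : WeierstrassCurve ℚ) [W.IsElliptic] [W.IsGloballyMinimal] (p : ℕ) [Fact p.Prime],
      ClassX11b W p → ¬ Surj W p → (p = 5 ∨ p = 7) → p ∣ padicValInt p W.minimalDiscriminantInt → ¬ Ram W p →
      FHTwinLowerSupplyAt W p ∧
      (∃ (K : Type) (_ : Field K) (_ : NumberField K), IsImaginaryQuadratic K ∧ 4 < (NumberField.discr K).natAbs ∧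
        SatisfiesHeegnerHypothesis (W.conductorNorm ℤ) K ∧ SatisfiesHeegnerHypothesis 2 K ∧
        (W.quadraticTwist (NumberField.discr K : ℚ)).entireLFunction 1 ≠ 0 ∧
        ∀ (Wd : WeierstrassCurve ℚ) [Wd.IsElliptic] [Wd.IsGloballyMinimal] (Cd : VariableChange ℚ),
          Cd • W.quadraticTwist (NumberField.discr K : ℚ) = Wd → ¬ Surj Wd p → Typed.MissingLowerBoundAt Wd p) := by
  intro W _ _ p _ hX hns h57 hv hnr
  refine ⟨NonSurjCorner.fhTwinLowerSupplyAt_of_lowerLeafTwinDeep hGZK hmod hnf hFH h₄ℓ W p hX hns h57 hv hnr, ?_⟩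
  have hp : p.Prime := Fact.out
  obtain ⟨hr, hp2, hmult, hirr⟩ := id hX
  have hw : W.rootNumber = -1 := by
    rw [WeierstrassCurve.rootNumber_eq_neg_one_pow_analyticRank_of_exists_isNewformOf hnf W, hr]
    norm_num
  -- the ONE-PRIME Friedberg–Hoffstein fact at the prime 2: a Heegner field with 2 split, |d_K| > 4, L(E^{d_K},1) ≠ 0
  obtain ⟨K, _, _, hK, hdisc, hHN, hH2, hLt⟩ := hFHs W hw 2 Nat.prime_two 4
  refine ⟨K, inferInstance, inferInstance, hK, hdisc, hHN, hH2, hLt, fun Wd _ _ Cd hWd hnsd ↦ ?_⟩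
  have hD0 : (NumberField.discr K : ℚ) ≠ 0 := by exact_mod_cast NumberField.discr_ne_zero K
  haveI : (W.quadraticTwist (NumberField.discr K : ℚ)).IsElliptic := W.isElliptic_quadraticTwist hD0
  have hrd : Wd.analyticRank = 0 := by
    rw [← hWd, analyticRank_smul]
    exact analyticRank_eq_zero_of_entireLFunction_one_ne_zero _ hLt
  have hXa : ClassX11a Wd p := classX11a_twist_of_not_ram W p hX hnr K hK hHN Cd hWd hrd
  have hsq := isSquare_discr_padic_of_heegner K hK hHN p (dvd_conductorNorm_of_mult hmult)
  have hvd : p ∣ padicValInt p Wd.minimalDiscriminantInt := by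
    rw [padicValInt_minimalDiscriminantInt_twist_eq W p hD0 hsq Cd hWd]
    exact hv
  by_cases hu : X11a.ShaAnUnit Wd p
  · obtain ⟨q, hq, hvq⟩ := hu
    exact ⟨q, hq, by rw [hvq]; exact_mod_cast Nat.zero_le _⟩
  · exact h₄ℓ Wd p hXa hnsd h57 hvd hu

/-- **r19's slots 2′ (μ = 0 at the leaf twins with non-unit `#Ш_an`) + 4 (six Hida facts) + the Kato ∕ SW ∕ GS ∕ Mazur facts imply slot 2″** (x11a's
per-pair door `ClassX11a.missingLowerBoundAt_of_muAnZeroAt_of_not_surj_of_contraFacts_of_mazur`, then `twinLowerSupply_of_lowerLeafTwinDeep`).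
So registering r20 loses nothing. [cite: EmertonPollackWeston2006, Thm. 5.1.3] [cite: Wan2015, Thm. 4] [cite: Mazur1978, Cor. 4.1] -/
theorem twinLowerSupply_of_twinLowerMuAn_of_hidaFacts
    (hGZK : rank_eq_analyticRank_of_analyticRank_le_one) (hmod : hasEntireLFunction_rat) (hnf : exists_isNewformOf)
    (hFHs : friedbergHoffstein_exists_heegnerField_split_twist_ne_zero) (hFH : friedbergHoffstein_exists_twist_ne_zero_inertAt)
    (h311 : thm311_cotorsion_weightK_member_ofLevel) (hT1a : thm1_muAlg_of_weightK_member_ofLevel)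
    (hT2 : Wan2015.thm4_rational_weightK_member_of_bdd_ofLevel_irred)
    (hT1b : thm513_transfer_from_weightK_member_of_bdd_ofLevel)
    (h61 : DeligneSerre1974.thm61_exists_adicGaloisRep) (h326 : Hida2000_thm326_ordinary)
    (h12 : Kato2004.thm12_4)
    (hns' : Kato2004.exists_multDivisibilityInputs_nonsplit_contra)
    (hsp' : Kato2004.exists_multDivisibilityInputs_split_contra)
    (hfine' : Kato2004.exists_multDivisibilityInputs_fine_contra)
    (hMaz : mazur_not_dvd_maninConstant_of_odd)
    (hJs : thm61_splitMultiplicative) (hJn : thm61_nonsplitMultiplicative)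
    (hGS : ∀ (W : WeierstrassCurve ℚ) [W.IsElliptic] [W.IsGloballyMinimal] (p : ℕ) [Fact p.Prime], greenberg_stevens (W := W) (p := p))
    (hμT : ∀ (Wd : WeierstrassCurve ℚ) [Wd.IsElliptic] [Wd.IsGloballyMinimal] (p : ℕ) [Fact p.Prime],
        ClassX11a Wd p → ¬ Surj Wd p → (p = 5 ∨ p = 7) → p ∣ padicValInt p Wd.minimalDiscriminantInt →
        ¬ X11a.ShaAnUnit Wd p →
        ∀ {N : ℕ} [NeZero N] (f : CuspForm (Gamma0 N) 2), IsNewformOf Wd f →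
        ∀ (ϖ : ℚ), (ϖ : ℝ) * Wd.realPeriodRat = plusPeriod f →
        ∀ (a : ℚ_[p]) (L : PowerSeries ℚ_[p]),
          (Wd.HasSplitMultiplicativeReductionAtPrime p → a = 1) →
          (¬ Wd.HasSplitMultiplicativeReductionAtPrime p → a = -1) →
          IsMultPAdicLFunctionOf f p a L →
          ∃ n : ℕ, ‖PowerSeries.coeff n (PowerSeries.C ((ϖ : ℚ) : ℚ_[p]) * L)‖ = 1) :
    ∀ (W : WeierstrassCurve ℚ) [W.IsElliptic] [W.IsGloballyMinimal] (p : ℕ) [Fact p.Prime],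
      ClassX11b W p → ¬ Surj W p → (p = 5 ∨ p = 7) → p ∣ padicValInt p W.minimalDiscriminantInt → ¬ Ram W p →
      FHTwinLowerSupplyAt W p ∧
      (∃ (K : Type) (_ : Field K) (_ : NumberField K), IsImaginaryQuadratic K ∧ 4 < (NumberField.discr K).natAbs ∧
        SatisfiesHeegnerHypothesis (W.conductorNorm ℤ) K ∧ SatisfiesHeegnerHypothesis 2 K ∧
        (W.quadraticTwist (NumberField.discr K : ℚ)).entireLFunction 1 ≠ 0 ∧
        ∀ (Wd : WeierstrassCurve ℚ) [Wd.IsElliptic] [Wd.IsGloballyMinimal] (Cd : VariableChange ℚ),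
          Cd • W.quadraticTwist (NumberField.discr K : ℚ) = Wd → ¬ Surj Wd p → Typed.MissingLowerBoundAt Wd p) :=
  twinLowerSupply_of_lowerLeafTwinDeep hGZK hmod hnf hFHs hFH fun Wd _ _ p _ hXa hnsd h57 hvd hsu ↦
    hXa.missingLowerBoundAt_of_muAnZeroAt_of_not_surj_of_contraFacts_of_mazur hnf h311 hT1a hT2 hT1b h61 h326 h12 hns'
      hsp' hfine' hMaz hJs hJn hGZK (hGS Wd p) hnsd (by rcases h57 with rfl | rfl <;> omega)
      (NonSurjChain.muAnZeroAt_of_allowableRootShape Wd p (fun f hf ϖ hϖ a L h1 h2 hL ↦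
        hμT Wd p hXa hnsd h57 hvd hsu f hf ϖ hϖ a L h1 h2 hL))

/-- **Crux 19064 (`X11aLowerHalf`, BY NAME) implies slot 2″** (a fortiori, via `lowerLeafTwinDeep_of_x11aLowerHalf`). [cite: Miller2011LMS, Def. 1.1] -/
theorem twinLowerSupply_of_x11aLowerHalf
    (hGZK : rank_eq_analyticRank_of_analyticRank_le_one) (hmod : hasEntireLFunction_rat) (hnf : exists_isNewformOf)
    (hFHs : friedbergHoffstein_exists_heegnerField_split_twist_ne_zero) (hFH : friedbergHoffstein_exists_twist_ne_zero_inertAt)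
    (h₃ : Summit.BirchSwinnertonDyer.BirchSwinnertonDyer.Theses.ErratumRoadFive.X11aLowerHalf) :
    ∀ (W : WeierstrassCurve ℚ) [W.IsElliptic] [W.IsGloballyMinimal] (p : ℕ) [Fact p.Prime],
      ClassX11b W p → ¬ Surj W p → (p = 5 ∨ p = 7) → p ∣ padicValInt p W.minimalDiscriminantInt → ¬ Ram W p →
      FHTwinLowerSupplyAt W p ∧
      (∃ (K : Type) (_ : Field K) (_ : NumberField K), IsImaginaryQuadratic K ∧ 4 < (NumberField.discr K).natAbs ∧
        SatisfiesHeegnerHypothesis (W.conductorNorm ℤ) K ∧ SatisfiesHeegnerHypothesis 2 K ∧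
        (W.quadraticTwist (NumberField.discr K : ℚ)).entireLFunction 1 ≠ 0 ∧
        ∀ (Wd : WeierstrassCurve ℚ) [Wd.IsElliptic] [Wd.IsGloballyMinimal] (Cd : VariableChange ℚ),
          Cd • W.quadraticTwist (NumberField.discr K : ℚ) = Wd → ¬ Surj Wd p → Typed.MissingLowerBoundAt Wd p) :=
  twinLowerSupply_of_lowerLeafTwinDeep hGZK hmod hnf hFHs hFH (lowerLeafTwinDeep_of_x11aLowerHalf h₃)


/-! ### §3 The by-items glue in SHAPE D (children {DeepWitness, TwinLowerSupply, Kato child}; crux 19064 NOT in the cone) -/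

/-- **The phase-1b-style glue in SHAPE D, modulo SIX top-level items** (binder order as RULING 66 (e), WITHOUT `X11aLowerHalf`): from `PublishedInputsFive`
(19066), `EulerHalfGrossPrintFacts` (27981), `ShimuraParametrizationDataNonempty` (19524), `PastenComponentOrdersInput` (19716), `ShimuraCasselsTateLevelInputs`
(20191), `ShimuraCarrierLabelsB6FromFive` (27982), the implication ‹deep witness (r19 ∕ r20 slot 1′)› → ‹twin-lower SUPPLIES (r20 slot 2″)› → ‹the fifteen twin
facts (= `KatoTwinFactsFiveAnContra`)› → `NonSurjCorner` — the corner's dependence on the twin's lower half is DISPLAYED inside the supply child (as an ∃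
over Friedberg–Hoffstein ∕ Heegner frames) instead of through the alias of crux 19064. The SHAPE-B children imply these (`deepWitness_of_kolyZShaAn_of_twinMuAnDeep`;
`twinLowerSupply_of_x11aLowerHalf` from the alias). Offered for a later re-split; nothing is filed here. Proof: glue #22 with INDEX-FREE LAB ⟹ slot 6 via
`EulerHalfLABIndexGuard.carrierLabelsB6AtFive_of_indexFree` at `p ∈ {5,7}` and the FOUR Shimura names from 19066 conj 13 + the three items. CONDITIONAL; 19065
NOT closed by this file; T7. [cite: Cha2005, Thm. 21 and Rmk. 25] [cite: HoffsteinLuo1997, Theorem (§1)] [cite: PastenShimura2024, Lemma 6.18] [cite: Miller2011LMS, Def. 1.1] -/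
theorem nonSurjCornerOfItemsSupply_holds
    (h₅ : PublishedInputsFive) (hF2 : EulerHalfGrossPrintFacts)
    (hJL : ShimuraParametrizationDataNonempty) (hCO : PastenComponentOrdersInput) (hCTi : ShimuraCasselsTateLevelInputs)
    (hLab : ShimuraCarrierLabelsB6FromFive) :
    -- child 1: ONE DEEP WITNESS per deep corner pair
    (∀ (W : WeierstrassCurve ℚ) [W.IsElliptic] [W.IsGloballyMinimal] (p : ℕ) [Fact p.Prime],
        ClassX11b W p → ¬ Surj W p → (p = 5 ∨ p = 7) → p ∣ padicValInt p W.minimalDiscriminantInt →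
        ¬ Ram W p → (∃ s : ℚ, shaAn W = (s : ℂ) ∧ 0 < padicValRat p s) →
        ∃ (N : ℕ) (_ : NeZero N) (K : Type) (_ : Field K) (_ : NumberField K)
          (Dt : ModularParametrizationData W N) (H : HeegnerDatum N (NumberField.discr K)) (ι : K →+* ℂ)
          (P : (W.baseChange K).toAffine.Point),
          W.conductorNorm ℤ = N ∧ IsImaginaryQuadratic K ∧ 4 < (NumberField.discr K).natAbs ∧
          SatisfiesHeegnerHypothesis N K ∧ (W.quadraticTwist (NumberField.discr K : ℚ)).entireLFunction 1 ≠ 0 ∧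
          WeierstrassCurve.Affine.Point.map ι.toRatAlgHom P = heegnerPointComplex Dt H ∧ ¬ (p : ℤ) ∣ Dt.c ∧
          ((∃ (d₁ : KolyvaginHeegnerData Dt H.β ι 1) (y : (W.baseChange K).toAffine.Point),
              WeierstrassCurve.Affine.Point.map (W' := W) (algebraMap K (ringClassField K ι 1)).toRatAlgHom y =
                d₁.derivedPoint ∧
              ∃ Q : (W.baseChange K).toAffine.Point, ((p ^ (padicValNat p W.tamagawaProduct + 1) : ℕ) : ℤ) • Q = y) →
            ∃ M : ℕ, M ≤ padicValNat p W.tamagawaProduct ∧ CertificateAt Dt H.β ι p M) ∧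
          (∀ (Wd : WeierstrassCurve ℚ) [Wd.IsElliptic] [Wd.IsGloballyMinimal] (Cd : VariableChange ℚ),
            Cd • W.quadraticTwist (NumberField.discr K : ℚ) = Wd →
            ClassX11a Wd p → ¬ Surj Wd p → p ∣ padicValInt p Wd.minimalDiscriminantInt →
            ∀ {N : ℕ} [NeZero N] (f : CuspForm (Gamma0 N) 2), IsNewformOf Wd f →
            ∀ (ϖ : ℚ), (ϖ : ℝ) * Wd.realPeriodRat = plusPeriod f →
            ∀ (a : ℚ_[p]) (L : PowerSeries ℚ_[p]),
              (Wd.HasSplitMultiplicativeReductionAtPrime p → a = 1) →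
              (¬ Wd.HasSplitMultiplicativeReductionAtPrime p → a = -1) →
              IsMultPAdicLFunctionOf f p a L →
              ∃ n : ℕ, ‖PowerSeries.coeff n (PowerSeries.C ((ϖ : ℚ) : ℚ_[p]) * L)‖ = 1)) →
    -- child 2: the twin-lower SUPPLIES of every corner pair
    (∀ (W : WeierstrassCurve ℚ) [W.IsElliptic] [W.IsGloballyMinimal] (p : ℕ) [Fact p.Prime],
        ClassX11b W p → ¬ Surj W p → (p = 5 ∨ p = 7) → p ∣ padicValInt p W.minimalDiscriminantInt → ¬ Ram W p →
        FHTwinLowerSupplyAt W p ∧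
        (∃ (K : Type) (_ : Field K) (_ : NumberField K), IsImaginaryQuadratic K ∧ 4 < (NumberField.discr K).natAbs ∧
          SatisfiesHeegnerHypothesis (W.conductorNorm ℤ) K ∧ SatisfiesHeegnerHypothesis 2 K ∧
          (W.quadraticTwist (NumberField.discr K : ℚ)).entireLFunction 1 ≠ 0 ∧
          ∀ (Wd : WeierstrassCurve ℚ) [Wd.IsElliptic] [Wd.IsGloballyMinimal] (Cd : VariableChange ℚ),
            Cd • W.quadraticTwist (NumberField.discr K : ℚ) = Wd → ¬ Surj Wd p → Typed.MissingLowerBoundAt Wd p)) →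
    -- child 3: `KatoTwinFactsFiveAnContra` (the fifteen twin ∕ MAX facts), spelled out until the child is filed
    ((∀ (N : ℕ) [NeZero N] (W : WeierstrassCurve ℚ) (K : Type) [Field K] [NumberField K], Literature.NumberTheory.EllipticCurves.gross_zagier N W K) ∧
      (∀ (N : ℕ) [NeZero N] (W : WeierstrassCurve ℚ) (K : Type) [Field K] [NumberField K], Literature.NumberTheory.EllipticCurves.kolyvagin N W K) ∧
      Literature.NumberTheory.EllipticCurves.Wuthrich2014.sha_dvd_analyticSha ∧
      Literature.NumberTheory.EllipticCurves.rank_eq_analyticRank_of_analyticRank_le_one ∧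
      Literature.NumberTheory.EllipticCurves.ModularForms.exists_isNewformOf ∧
      Literature.NumberTheory.EllipticCurves.friedbergHoffstein_exists_heegnerField_split_twist_ne_zero ∧
      Literature.NumberTheory.EllipticCurves.ModularForms.mazur_not_dvd_maninConstant_of_odd ∧
      Literature.NumberTheory.EllipticCurves.SteinWuthrich2013.thm61_splitMultiplicative ∧
      Literature.NumberTheory.EllipticCurves.SteinWuthrich2013.thm61_nonsplitMultiplicative ∧
      (∀ (W : WeierstrassCurve ℚ) [W.IsElliptic] [W.IsGloballyMinimal] (p : ℕ) [Fact p.Prime], Literature.NumberTheory.EllipticCurves.greenberg_stevens (W := W) (p := p)) ∧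
      Literature.NumberTheory.EllipticCurves.Cha2005.rmk25_pow_dvd_card_sha_primary_of_certificate ∧
      Literature.NumberTheory.EllipticCurves.Kato2004.thm12_4 ∧
      Literature.NumberTheory.EllipticCurves.Kato2004.exists_multDivisibilityInputs_nonsplit_contra ∧
      Literature.NumberTheory.EllipticCurves.Kato2004.exists_multDivisibilityInputs_split_contra ∧
      Literature.NumberTheory.EllipticCurves.Kato2004.exists_multDivisibilityInputs_fine_contra) →
    NonSurjCorner :=
  fun hWit hSup2 hF ↦
    nonSurjCorner_of_deepWitness_of_twinLowerSupply_of_fifteenFacts_of_twoPlusFourNamedInputs_of_carrierLabelsB6_pAnchor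
      hWit hSup2 hF hF2 ⟨h₅.2.2.2.2.2.2.2.2.2.2.2.2.1, hJL, hCO, hCTi⟩
      (fun W _ _ p _ hX _ h57 ↦
        EulerHalfLABIndexGuard.carrierLabelsB6AtFive_of_indexFree h₅.2.2.2.2.2.2.1 h₅.2.2.2.2.2.1 hLab W p hX
          (by rcases h57 with rfl | rfl <;> norm_num))

end Summit.BirchSwinnertonDyer.BirchSwinnertonDyer.Theorems

end
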